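import Summits.BirchSwinnertonDyer.BirchSwinnertonDyer.Theorems.ResidualThetaTransportAtTwoRelativeLubinTatePoints
import HarnessLib

/-!
# The formal group of a supersingular model with `a_p = 0` is RELATIVE LUBIN–TATE for `(π, q) = (−p, p²)`, V:
# SEMILINEARITY ON POINTS — a ring endomorphism `σ` of the point ring lying over an endomorphism `τ` of the coefficient ring `A`
# satisfies `σ([a]·x) = [τ a]·(σ x)` and `σ(x ⊕ y) = σx ⊕ σy`; at `p = 2`: a Frobenius lift on `𝒪_{k'}` (`k' ⊇ ℚ₄`) acts on the `ℤ₄`-module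
# `Ê(𝔪_{k'})` SEMILINEARLY (`[ω] ↦ [ω²]`) — input (b) of the (UQ2) descent (`…SemilinearDescent`, p611163) (kernel)

Route `ResidualThetaTransportAtTwo` (RTT), crux (R≥)ᵖ `ResidualThetaCountLowerPureAtTwo` (stmt-BirchSwinnertonDyer-26074); seat
`prover-bsd-wall-rtt-p2` g9 (`--supports`, closes nothing); memo `Cruxes/ResidualThetaCountLowerPureAtTwo/RELATIVE-LT-g9.md` v2 §2 (input (b)).
Sequel of parts I–IV (p608987, p609616, p611245, p611519). HONEST FRAMING: THEOREMS ONLY (no definition, no named fact, no instance, no `sorry`);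
route-independent; nothing about any Selmer group; BSD is not proved by any of this.

WHAT (`A` a discretely uniformised commutative ring, `S` a complete Hausdorff linearly topologised `A`-algebra, `𝔪` a `LubinTate.NilIdeal S`;
`τ : A →+* A`, `σ : S →+* S` continuous with `σ ∘ algebraMap = algebraMap ∘ τ`; `f ∈ 𝔉_{−p}` (`q = p²`) with `f.map τ = f`, e.g. `f = i([p]X)`
of a model defined over the fixed ring of `τ`):
* `eval₂_map_eq` — `eval₂ φ a (g.map τ) = eval₂ (φ ∘ τ) a g` (topological evaluation is natural in the coefficients; termwise on the sums);
* `map_hom_eq_hom` — `[a]^τ = [τ a]` for every `τ` fixing `f` (part II's `map_hom_eq_hom_apply` without the `ℤ_p`-algebra packaging);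
* **`ringHom_ltSMul`** — `σ([a]·x) = [τ a]·(σ x)`; **`ringHom_ltAdd`** — `σ(x ⊕ y) = σx ⊕ σy` (when also `F.map τ = F`, e.g. `F = F_U` for `U`
  over the fixed ring); `ringHom_evalPt₁` — the general transport `σ(g(x)) = (g^τ)(σ x)`.
With `τ` = Frobenius of `ℤ₄ = 𝒪_{ℚ₂(ζ₃)}` (`ζ₃ ↦ ζ₃²`) and `σ` a Frobenius lift on `𝒪_{k'}`: `σ([ω]x) = [ω²](σx)`, the semilinearity hypothesis
`φ(ω•x) = ω²•φ(x)` of `SemilinearDescent` for `M = Ê(𝔪_{k'})` (and for `E⁺(k')` once the trace condition is checked to be `σ`-stable).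

References: [CasselsFrohlichANT1967] Ch. VI §3.6 Prop. 6 (b) (Galois commutes with `[a]`); [LubinTate1965] §1; [deShalit1987] Ch. I §1.2.
-/

set_option autoImplicit false
-- the Theorems namespace of this sub repeats the summit name by design (D-0017 nested layout)
set_option linter.dupNamespace false

noncomputable section

open scoped Classical
open PowerSeries Literature.NumberTheory.GaloisRepresentations

namespace Summit.BirchSwinnertonDyer.BirchSwinnertonDyer.Theorems.RelativeLubinTate

section Semilinear

variable {p : ℕ} {A : Type*} [CommRing A] [UniformSpace A] [DiscreteUniformity A]
  {S : Type*} [CommRing S] [UniformSpace S] [IsUniformAddGroup S] [IsTopologicalRing S]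
  [IsLinearTopology S S] [T2Space S] [CompleteSpace S] [Algebra A S] [ContinuousSMul A S]
  (𝔪 : LubinTate.NilIdeal S)

omit [Algebra A S] [ContinuousSMul A S] in
/-- **Topological evaluation is natural in the coefficients**: `eval₂ φ a (g.map τ) = eval₂ (φ ∘ τ) a g` (both are the sum of
`φ(τ(g_d))·a^d`). [folklore] -/
theorem eval₂_map_eq {ι : Type*} [Finite ι] {R : Type*} [CommRing R] [UniformSpace R] [DiscreteUniformity R]
    (τ : R →+* A) (φ : A →+* S) (hφ : Continuous φ) {a : ι → S} (ha : MvPowerSeries.HasEval a)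
    (g : MvPowerSeries ι R) :
    MvPowerSeries.eval₂ φ a (MvPowerSeries.map τ g) = MvPowerSeries.eval₂ (φ.comp τ) a g := by
  have hφτ : Continuous (φ.comp τ) := hφ.comp continuous_of_discreteTopology
  rw [MvPowerSeries.eval₂_eq_tsum hφ ha, MvPowerSeries.eval₂_eq_tsum hφτ ha]
  refine tsum_congr fun d ↦ ?_
  rw [MvPowerSeries.coeff_map, RingHom.comp_apply]

variable (τ : A →+* A) (σ : S →+* S) (hσ : Continuous σ) (hστ : ∀ a : A, σ (algebraMap A S a) = algebraMap A S (τ a))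

include hσ hστ in
/-- **Transport of evaluation along `(σ, τ)`**: `σ(g(x)) = (g^τ)(σ x)` for a constant-term-free series `g ∈ A⟦X⟧` and a point `x ∈ 𝔪` with
`σ x ∈ 𝔪`. [cite: CasselsFrohlichANT1967, Ch. VI §3.6 Prop. 6 (b) (proof)] -/
theorem ringHom_evalPt₁ (g : PowerSeries A) (hg : PowerSeries.constantCoeff g = 0) (x : 𝔪.toIdeal) (hx : σ x ∈ 𝔪.toIdeal) :
    σ (LubinTate.evalPt₁ 𝔪 g hg x : S) =
      (LubinTate.evalPt₁ 𝔪 (PowerSeries.map τ g) (by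
        rw [← coeff_zero_eq_constantCoeff_apply, coeff_map, coeff_zero_eq_constantCoeff_apply, hg, map_zero]) ⟨σ x, hx⟩ : S) := by
  unfold LubinTate.evalPt₁
  rw [LubinTate.coe_evalPt, LubinTate.coe_evalPt, MvPowerSeries.coe_aeval, MvPowerSeries.coe_aeval]
  have hcont : Continuous (algebraMap A S) := continuous_algebraMap A S
  have h1 := congrFun (MvPowerSeries.comp_eval₂ hcont (𝔪.hasEval fun _ : Unit ↦ x) (ε := σ) hσ) g
  rw [Function.comp_apply] at h1
  rw [h1]
  have hcomp : σ.comp (algebraMap A S) = (algebraMap A S).comp τ := RingHom.ext hστ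
  rw [hcomp]
  change MvPowerSeries.eval₂ ((algebraMap A S).comp τ) (fun i : Unit ↦ σ ((fun _ : Unit ↦ (x : S)) i)) g = _
  rw [← eval₂_map_eq τ (algebraMap A S) hcont (𝔪.hasEval fun _ : Unit ↦ (⟨σ x, hx⟩ : 𝔪.toIdeal)) g]
  rfl

variable (hA : LubinTate.IsLTRing (-(p : A)) (p ^ 2)) {f : PowerSeries A} (hf : LubinTate.IsLTSeries (-(p : A)) (p ^ 2) f)

include hστ in
omit [UniformSpace A] [DiscreteUniformity A] [UniformSpace S] [IsUniformAddGroup S] [IsTopologicalRing S] [IsLinearTopology S S]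
  [T2Space S] [CompleteSpace S] [ContinuousSMul A S] in
/-- `τ` fixes `−p` (it fixes the image of `ℤ`). [folklore] -/
theorem map_neg_natCast : τ (-(p : A)) = -(p : A) := by
  have _ := hστ
  rw [map_neg, map_natCast]

omit [UniformSpace A] [DiscreteUniformity A] in
/-- **`[a]^τ = [τ a]`** for every ring endomorphism `τ` of `A` fixing `f`: `[a]^τ` commutes with `f^τ = f` and has linear term `τ a`.
[cite: LubinTate1965, §1 Lemma 1] -/
theorem map_hom_eq_hom (hfτ : PowerSeries.map τ f = f) (a : A) :
    PowerSeries.map τ (LubinTate.hom hA hf hf a) = LubinTate.hom hA hf hf (τ a) := by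
  refine LubinTate.eq_hom hA hf hf ?_ ?_ ?_
  · rw [← coeff_zero_eq_constantCoeff_apply, coeff_map, coeff_zero_eq_constantCoeff_apply,
      LubinTate.constantCoeff_hom, map_zero]
  · rw [coeff_map, LubinTate.coeff_one_hom]
  · have h := congrArg (PowerSeries.map τ) (LubinTate.subst_hom hA hf hf a)
    rw [WeierstrassCurve.powerSeries_map_subst _
        (HasSubst.of_constantCoeff_zero' (LubinTate.constantCoeff_hom hA hf hf a)),
      WeierstrassCurve.powerSeries_map_subst _ (HasSubst.of_constantCoeff_zero' hf.constantCoeff_eq_zero),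
      hfτ] at h
    exact h

include hσ hστ in
/-- **Semilinearity on points: `σ([a]·x) = [τ a]·(σ x)`** (`f^τ = f`). With `τ` the Frobenius of `ℤ₄` and `σ` a Frobenius lift on `𝒪_{k'}`:
`σ([ω]x) = [ω²](σx)` on `Ê(𝔪_{k'})`. [cite: CasselsFrohlichANT1967, Ch. VI §3.6 Prop. 6 (b)] [cite: deShalit1987, Ch. I §1.2] -/
theorem ringHom_ltSMul (hfτ : PowerSeries.map τ f = f) (a : A) (x : 𝔪.toIdeal) (hx : σ x ∈ 𝔪.toIdeal) :
    σ (LubinTate.ltSMul 𝔪 hA hf a x : S) = (LubinTate.ltSMul 𝔪 hA hf (τ a) ⟨σ x, hx⟩ : S) := by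
  unfold LubinTate.ltSMul
  rw [ringHom_evalPt₁ 𝔪 τ σ hσ hστ _ _ x hx]
  -- `[a]^τ = [τ a]`
  have key := map_hom_eq_hom τ hA hf hfτ a
  unfold LubinTate.evalPt₁
  exact congrArg (fun t : 𝔪.toIdeal ↦ (t : S)) (LubinTate.evalPt_congr 𝔪 key _ _ _)

include hσ hστ in
/-- **`σ(x ⊕ y) = σx ⊕ σy`** when the group law is fixed by `τ` (e.g. `F_U` for a model `U` over the fixed ring of `τ`).
[cite: CasselsFrohlichANT1967, Ch. VI §3.2] -/
theorem ringHom_ltAdd (hFτ : MvPowerSeries.map τ (LubinTate.ltF hA hf) = LubinTate.ltF hA hf) (x y : 𝔪.toIdeal)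
    (hx : σ x ∈ 𝔪.toIdeal) (hy : σ y ∈ 𝔪.toIdeal) :
    σ (LubinTate.ltAdd 𝔪 hA hf x y : S) = (LubinTate.ltAdd 𝔪 hA hf ⟨σ x, hx⟩ ⟨σ y, hy⟩ : S) := by
  unfold LubinTate.ltAdd LubinTate.addPt
  rw [LubinTate.coe_evalPt, LubinTate.coe_evalPt, MvPowerSeries.coe_aeval, MvPowerSeries.coe_aeval]
  have hcont : Continuous (algebraMap A S) := continuous_algebraMap A S
  have h1 := congrFun (MvPowerSeries.comp_eval₂ hcont (𝔪.hasEval ![x, y]) (ε := σ) hσ)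
    (LubinTate.formalGroup hA hf).toPowerSeries
  rw [Function.comp_apply] at h1
  rw [h1, show σ.comp (algebraMap A S) = (algebraMap A S).comp τ from RingHom.ext hστ]
  change MvPowerSeries.eval₂ ((algebraMap A S).comp τ) (fun i : Fin 2 ↦ σ ((fun j : Fin 2 ↦ ((![x, y] j : 𝔪.toIdeal) : S)) i)) _ = _
  rw [← eval₂_map_eq τ (algebraMap A S) hcont (((𝔪.hasEval ![x, y])).map hσ), LubinTate.formalGroup_toPowerSeries, hFτ]
  have key : ∀ (F : MvPowerSeries (Fin 2) A) (g₁ g₂ : Fin 2 → S) (h₁ : MvPowerSeries.HasEval g₁)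
      (h₂ : MvPowerSeries.HasEval g₂), g₁ = g₂ →
      MvPowerSeries.eval₂ (algebraMap A S) g₁ F = MvPowerSeries.eval₂ (algebraMap A S) g₂ F := by
    rintro F g₁ g₂ h₁ h₂ rfl; rfl
  exact key _ _ _ ((𝔪.hasEval ![x, y]).map hσ) (𝔪.hasEval ![⟨σ x, hx⟩, ⟨σ y, hy⟩]) (funext fun i ↦ by fin_cases i <;> rfl)

/-- For a model `U` over the FIXED RING of `τ` (all coefficients `aᵢ` fixed), `F_U` and `i([p]X)` are fixed by `τ`: the hypotheses `hFτ`,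
`hfτ` above. [folklore] -/
theorem map_eq_of_coeffs_fixed {R : Type*} [CommRing R] (ρ : R →+* R) (U : WeierstrassCurve R) (hU : U.map ρ = U) (n : ℕ) :
    MvPowerSeries.map ρ U.formalGroupLaw = U.formalGroupLaw ∧
      PowerSeries.map ρ (U.formalNeg.subst (U.formalMul n)) = U.formalNeg.subst (U.formalMul n) := by
  refine ⟨?_, ?_⟩
  · rw [WeierstrassCurve.map_formalGroupLaw, hU]
  · rw [map_formalNeg_subst_formalMul' U ρ n, hU]

end Semilinear

end Summit.BirchSwinnertonDyer.BirchSwinnertonDyer.Theorems.RelativeLubinTate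

end
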